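import Literature.AnabelianGeometry.EtaleTheta.Discharge.Sec2Prop24OfCore
import Literature.AnabelianGeometry.EtaleTheta.Discharge.Sec2AutKDottedOfOdd
import Literature.AnabelianGeometry.EtaleTheta.ThetaCoversCommutatorTheta
import HarnessLib

/-!
# [EtTh] Prop. 2.4 over the interface: the core form SHRINKS to «extension stabilising `Π^tp_Ÿ`» (proof-only)

Mochizuki, *The étale theta function and its Frobenioid-theoretic manifestations* [EtTh], Publ. RIMS **45**
(2009), §2, Prop. 2.4, PRIMS PDF pp. 38–39 (printed pp. 264–265) [cite: MochizukiEtTh2009, Prop 2.4 p.38]; proof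
p. 39: «it follows from our assumption that the hyperbolic curve determined by `X^log` admits a `K`-core that `γ`
induces an isomorphism `Π^tp_{C_α} ⥲ Π^tp_{C_β}` [cf. [Mzk3], Theorem 2.4] … In light of these observations, the
various assertions of Proposition 2.4 follow immediately from the definitions»; Rmk. 2.6.1 p. 40
(`Aut_K(X̲̲) = μ_l × {±1}`, `Aut_K(C̲̲) = μ_l`, `Aut_K(C̲) = {1}`); Rmk. 2.1.1 p. 36 (`C̲ → C` is not Galois).
Cell abc-iut, layer L2, cone node EtTh:Prop2.4 (abc-iut-w4-d098 gen 8; second stamp on abc-iut-L2-lead's row #127,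
holder of record abc-iut-w6-d094).  SEQUEL of abc-iut-w6-d094's `Sec2Prop24OfCore.lean` (`prop24_iff_core`: the
typed `TemperedCoverData.Prop24` — FACT-LIST F-0609, `19` stabilisations — is equivalent, granted Def. 2.5 (i)(a)
`Π^tp_Y ≤ Π^tp_{X̲}`, to a CORE of `7` stabilisations: (i) `Π^tp_{C̲̲}, Π^tp_Ÿ`; (ii) `Π^tp_Ÿ`; (iii) `Π^tp_X, Π^tp_Ÿ`;
(iv) `Π^tp_X, Π^tp_Ÿ`).  PURE GROUP THEORY over abc-iut-L2-t2's interface `ThetaCovers.TemperedCoverData`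
(`ThetaCoversTempered.lean`, DEFS-FROZEN, not edited); no definition, no instance, no named fact; everything of
abc-iut-L2-d3 / L2-t7 / L2-t12 / L6-t23 / w6-d084 / w6-d094 is consumed BY NAME.

THE POINT.  Three of the seven core stabilisations are THEOREMS over the interface as well, so that — for `l ≠ 1`,
under `μ_l ⊆ K` (`T.HasMuL`, the standing hypothesis of Rmk. 2.6.1 / Cor. 2.9) and the printed definition
`hΘ : ⁅Δ_X, Δ_X⁆·Ker = Δ̄_Θ`-preimage of `Δ_Θ` («`Δ_Θ := Im(∧² Δ^ab_X)`», p. 12; abc-iut-L2-t2's predicate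
`CoverData.IsCommutatorTheta`, a theorem at the genuine setting-born data) — the typed Prop. 2.4 is EQUIVALENT to
the uniform statement «for each member `Z ∈ {X̲̲, X̲, C̲̲, C̲}`, every topological automorphism of `Π^tp_Z` extends to
a topological automorphism of `Π^tp_C` stabilising `Π^tp_Ÿ`» (`prop24_iff_extendsStabilising_PiYddtp`), with NO
Def. 2.5 (i)(a) hypothesis:
* **`X̲` from `C̲`, for ANY automorphism `Γ` of `Π^tp_C` with `Γ(Π^tp_{C̲}) = Π^tp_{C̲}`** (`l ≠ 1`;
  `map_tp_PiXu_eq_of_map_tp_PiCu`): `Π^tp_{X̲} ⊴ Π^tp_C` (abc-iut-L6-t23 `tpPiXu_normal`) is maximal in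
  `Π^tp_{C̲}` (index `2`) and `Π^tp_{C̲}` is self-normalising (Rmk. 2.1.1, `normalizer_tpPiCu_eq`) but not all of
  `Π^tp_C` (`[Π^tp_C : Π^tp_{C̲}] = l ≠ 1`); so `Π^tp_{X̲}` is the NORMAL CORE of `Π^tp_{C̲}` — the normal subgroup
  `Γ(Π^tp_{X̲}) ⊔ Π^tp_{X̲}` of `Π^tp_C` lies between `Π^tp_{X̲}` and `Π^tp_{C̲}`, hence is `Π^tp_{X̲}`
  (`Subgroup.map_eq_of_normal_of_relIndex_two`).  With the index-`2` argument of abc-iut-L2-t7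
  (`map_tp_PiX_eq_of_PiXu`, `4 ∤ 2l`) this gives **`X` from `C̲`**, and, through `N_{Π^tp_C}(Π^tp_{C̲̲}) = Π^tp_{C̲}`
  (`μ_l ⊆ K`, abc-iut-L6-t23 `normalizer_tpPiCuu_eq`), **`X` from `C̲̲`**: the `X`-conjunct of w6-d094's core in
  clauses (iii)/(iv) is derived (their docstring's «versus quadratic twists» does not arise: a quadratic twist of
  `Π^tp_X` does not contain `Π^tp_{X̲}`, which maps ONTO `G_K`).
* **`C̲̲` from `X̲̲`, for ANY `Γ` with `Γ(Π^tp_{X̲̲}) = Π^tp_{X̲̲}`** (`μ_l ⊆ K`, `hΘ`; `map_tp_PiCuu_eq_of_map_tp_PiXuu`):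
  `Γ` stabilises `N_{Π^tp_C}(Π^tp_{X̲̲}) = Π^tp_{C̲}` (abc-iut-L2-t12 `normalizer_tpPiXuu_eq`), so `Γ(Π^tp_{C̲̲})` and
  `Π^tp_{C̲̲}` are two subgroups of `Π^tp_{C̲} = N(Π^tp_{C̲̲})` of index `2` over `Π^tp_{X̲̲}`; if they differed, their
  intersection would be `Π^tp_{X̲̲}` and `[Γ(Π^tp_{C̲̲})·Π^tp_{C̲̲} : Π^tp_{C̲̲}] = 2` would divide the ODD index
  `[Π^tp_{C̲} : Π^tp_{C̲̲}] = l` (`Subgroup.eq_of_relIndex_two_of_odd_relIndex`; in print: `Aut_K(X̲̲) = μ_l × {±1}` has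
  a unique involution, Rmk. 2.6.1).
WHAT PRINT'S HYPOTHESES LEAVE TO PROVE (census of record, v2) is therefore exactly the two inputs of the printed
proof that are absolute anabelian geometry and that no structure of the tree carries: (E) the EXTENSION of `γ` to
`Π^tp_C` («admits a `K`-core», [Mzk3] Thm. 2.4) and (Ÿ) `Γ(Π^tp_Ÿ) = Π^tp_Ÿ` (the theta quotient / «as in the proof
of Proposition 1.8»: [AbsAnab] Lem. 1.3.8, [SemiAnbd] Thm. 6.5 (iii), Thm. 1.6 (i), Prop. 2.2).  At the tree's
semi-synthetic models already (E) fails (abc-iut-f-143 `not_forall_prop24`, abc-iut-f-151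
`not_prop24_temperedCoverData_inversionModelκ'`).  HONEST FRAMING: nothing here asserts that a `TemperedCoverData`
satisfying `Prop24` exists, nor anything about genuine tempered fundamental groups; F-0609 stays a named input where
consumed; reduced-to-named-inputs ≠ proved-in-print; typed ≠ proved; no side is taken on [IUTchIII] Cor. 3.12 or on
any disputed claim.
-/

namespace Literature.AnabelianGeometry.EtaleTheta

namespace ThetaCovers

universe u

/-! ### Group theory: normal cores of self-normalising subgroups; index `2` against odd index -/

section GroupTheory

variable {G : Type*} [Group G]

/-- If `K.map e = K` for a group automorphism `e`, then also `K.map e⁻¹ = K`. [folklore] -/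
private theorem map_symm_eq_of_map_eq' (e : G ≃* G) {K : Subgroup G} (h : K.map e.toMonoidHom = K) :
    K.map e.symm.toMonoidHom = K := by
  conv_lhs => rw [← h]
  have hid : e.symm.toMonoidHom.comp e.toMonoidHom = MonoidHom.id G := by ext x; simp
  rw [Subgroup.map_map, hid, Subgroup.map_id]

/-- **A normal subgroup of index `2` in a self-normalising proper subgroup is its normal core, hence is stabilised
by every automorphism stabilising the subgroup**: `K ⊴ G`, `K ≤ B` with `[B : K] = 2`, `N_G(B) ≠ G`, and
`e ∈ Aut(G)` with `e(B) = B`; then `e(K) = K` — for `e(K) ⊔ K` is normal in `G` and lies between `K` and `B`, and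
it cannot be `B` (which is not normal).  In [EtTh] §2: `Π^tp_{X̲}` is recovered from `Π^tp_{C̲}` (Rmk. 2.1.1:
`C̲ → C` is not Galois, `X̲ → C` is). [cite: MochizukiEtTh2009, Rmk 2.1.1 p.36] -/
theorem _root_.Subgroup.map_eq_of_normal_of_relIndex_two {K B : Subgroup G} [hK : K.Normal] (hKB : K ≤ B)
    (h2 : K.relIndex B = 2) (hB : Subgroup.normalizer (B : Set G) ≠ ⊤) (e : G ≃* G)
    (he : B.map e.toMonoidHom = B) : K.map e.toMonoidHom = K := by
  -- one inclusion, for every automorphism stabilising `B`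
  have key : ∀ f : G ≃* G, B.map f.toMonoidHom = B → K.map f.toMonoidHom ≤ K := by
    intro f hf
    haveI : (K.map f.toMonoidHom).Normal := Subgroup.Normal.map hK _ f.surjective
    have hJB : K ⊔ K.map f.toMonoidHom ≤ B := sup_le hKB (hf ▸ Subgroup.map_mono hKB)
    by_contra hle
    have hne : ¬ K ⊔ K.map f.toMonoidHom ≤ K := fun h => hle (le_sup_right.trans h)
    have hJ : K ⊔ K.map f.toMonoidHom = B := eq_of_relIndex_two_of_not_le h2 le_sup_left hJB hne
    haveI : (K ⊔ K.map f.toMonoidHom).Normal := inferInstance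
    exact hB (hJ ▸ Subgroup.normalizer_eq_top (K ⊔ K.map f.toMonoidHom))
  refine le_antisymm (key e he) fun k hk => ?_
  exact ⟨e.symm k, key e.symm (map_symm_eq_of_map_eq' e he) ⟨k, hk, rfl⟩, e.apply_symm_apply k⟩

/-- **Index `2` against odd index**: `A ≤ M, C ≤ B` with `[M : A] = [C : A] = 2`, `B ≤ N_G(C)` and `[B : C]` ODD;
then `M = C` — otherwise `M ∩ C = A`, so `[M·C : C] = [M : M ∩ C] = 2` would divide `[B : C]`.  (Equivalently: a
group of order `2k`, `k` odd, has at most one NORMAL subgroup of order `2`.)  In [EtTh] §2: `Π^tp_{C̲̲}` is the only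
index-`2` overgroup of `Π^tp_{X̲̲}` inside `Π^tp_{C̲}` (`Aut_K(X̲̲) = μ_l × {±1}` has a unique involution, Rmk. 2.6.1).
[cite: MochizukiEtTh2009, Rmk 2.6.1 p.40] -/
theorem _root_.Subgroup.eq_of_relIndex_two_of_odd_relIndex {A M C B : Subgroup G} (hAM : A ≤ M) (hAC : A ≤ C)
    (hMB : M ≤ B) (hCB : C ≤ B) (hBC : B ≤ Subgroup.normalizer (C : Set G)) (h2M : A.relIndex M = 2)
    (h2C : A.relIndex C = 2) (hodd : Odd (C.relIndex B)) : M = C := by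
  have hmul : A.relIndex (M ⊓ C) * (M ⊓ C).relIndex C = 2 := by
    rw [Subgroup.relIndex_mul_relIndex A (M ⊓ C) C (le_inf hAM hAC) inf_le_right, h2C]
  have hdvd : (M ⊓ C).relIndex C ∣ 2 := Dvd.intro_left _ hmul
  rcases (Nat.dvd_prime Nat.prime_two).mp hdvd with h1 | h1
  · -- `C ≤ M`, and the indices over `A` agree
    have hCM : C ≤ M := (Subgroup.relIndex_eq_one.mp h1).trans inf_le_left
    have h3 : A.relIndex C * C.relIndex M = A.relIndex M := Subgroup.relIndex_mul_relIndex A C M hAC hCM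
    rw [h2C, h2M] at h3
    have h4 : C.relIndex M = 1 := by omega
    exact le_antisymm (Subgroup.relIndex_eq_one.mp h4) hCM
  · exfalso
    rw [h1] at hmul
    have h5 : A.relIndex (M ⊓ C) = 1 := by omega
    -- `[M : M ∩ C] = 2`
    have h6 : (M ⊓ C).relIndex M = 2 := by
      have h := Subgroup.relIndex_mul_relIndex A (M ⊓ C) M (le_inf hAM hAC) inf_le_left
      rw [h5, one_mul, h2M] at h
      exact h
    have h7 : C.relIndex M = 2 := by rwa [Subgroup.inf_relIndex_left] at h6
    -- inside `B`, where `C` is normal: `[M ⊔ C : C] = [M : M ∩ C] = 2`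
    haveI : (C.subgroupOf B).Normal := (Subgroup.normal_subgroupOf_iff_le_normalizer hCB).mpr hBC
    have hJB : M ⊔ C ≤ B := sup_le hMB hCB
    have h8 : C.relIndex (M ⊔ C) = 2 := by
      rw [← Subgroup.relIndex_subgroupOf hJB, Subgroup.subgroupOf_sup hMB hCB,
        Subgroup.relIndex_sup_right (M.subgroupOf B) (C.subgroupOf B), Subgroup.relIndex_subgroupOf hMB, h7]
    have h9 : C.relIndex (M ⊔ C) * (M ⊔ C).relIndex B = C.relIndex B :=
      Subgroup.relIndex_mul_relIndex C (M ⊔ C) B le_sup_right hJB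
    rw [h8] at h9
    exact (Nat.not_even_iff_odd.mpr hodd) ⟨(M ⊔ C).relIndex B, by omega⟩

end GroupTheory

namespace TemperedCoverData

variable {l : ℕ} (T : TemperedCoverData.{u} l)

/-! ### Indices and inclusions of the tower inside `Π^tp_C` (bookkeeping) -/

/-- `Π^tp_{C̲̲} ≤ Π^tp_{C̲}` (`Π_{C̲} = Π_{C̲̲}·Δ̄_Θ`-preimage; a `private` copy of abc-iut-L2's
`tp_PiCuu_le_tp_PiCu` of `Sec2Cor28iiiOuterEndKnitChiCusp.lean`, not imported here).
[cite: MochizukiEtTh2009, Def 2.1 p.36] -/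
private theorem tp_PiCuu_le_tp_PiCu' : T.tp T.PiCuu ≤ T.tp T.PiCu :=
  Subgroup.comap_mono (le_sup_left : T.PiCuu ≤ T.PiCu)

/-- `Π^tp_{X̲̲} ≤ Π^tp_{C̲̲}` (`Π_{X̲̲} = Π_{C̲̲} ∩ Π_X`). [cite: MochizukiEtTh2009, Def 2.3 p.38] -/
theorem tp_PiXuu_le_tp_PiCuu : T.tp T.PiXuu ≤ T.tp T.PiCuu :=
  Subgroup.comap_mono (inf_le_left : T.PiXuu ≤ T.PiCuu)

/-- `[Π^tp_{C̲̲} : Π^tp_{X̲̲}] = 2` (indices `2l²` and `l²` in `Π^tp_C`). [cite: MochizukiEtTh2009, Rmk 2.3.1 p.38] -/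
theorem relIndex_tp_PiXuu_tp_PiCuu : (T.tp T.PiXuu).relIndex (T.tp T.PiCuu) = 2 := by
  have h := Subgroup.relIndex_mul_index T.tp_PiXuu_le_tp_PiCuu
  rw [T.index_tp_PiXuu, T.index_tp_PiCuu] at h
  have hll : 0 < l * l := Nat.mul_pos (Nat.pos_of_ne_zero T.toCoverData.l_ne_zero)
    (Nat.pos_of_ne_zero T.toCoverData.l_ne_zero)
  have h' : (T.tp T.PiXuu).relIndex (T.tp T.PiCuu) * (l * l) = 2 * (l * l) := by rw [h]; ring
  exact Nat.eq_of_mul_eq_mul_right hll h'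

/-- `[Π^tp_{C̲} : Π^tp_{C̲̲}] = l` (indices `l²` and `l` in `Π^tp_C`). [cite: MochizukiEtTh2009, Rmk 2.3.1 p.38] -/
theorem relIndex_tp_PiCuu_tp_PiCu : (T.tp T.PiCuu).relIndex (T.tp T.PiCu) = l := by
  have h := Subgroup.relIndex_mul_index T.tp_PiCuu_le_tp_PiCu'
  rw [T.index_tp_PiCuu, T.index_tp_PiCu] at h
  exact Nat.eq_of_mul_eq_mul_right (Nat.pos_of_ne_zero T.toCoverData.l_ne_zero) h

/-- `Π^tp_{C̲}` is NOT normal in `Π^tp_C` when `l ≠ 1`: it is self-normalising (Rmk. 2.1.1) of index `l`.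
[cite: MochizukiEtTh2009, Rmk 2.1.1 p.36] -/
theorem normalizer_tp_PiCu_ne_top (hl : l ≠ 1) :
    Subgroup.normalizer ((T.tp T.PiCu : Subgroup T.Gtp) : Set T.Gtp) ≠ ⊤ := by
  rw [T.normalizer_tpPiCu_eq]
  intro h
  apply hl
  rw [← T.index_tp_PiCu, h, Subgroup.index_top]

/-! ### The derived stabilisations, for ANY topological automorphism `Γ` of `Π^tp_C` -/

variable {T}

/-- **`X` from `X̲̲`** (abc-iut-L2-t7's index-`2` argument with `4 ∤ [Π_C : Π_{X̲̲}] = 2l²` discharged, `l` odd).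
[cite: MochizukiEtTh2009, Prop 2.4 p.38] -/
theorem map_tp_PiX_eq_of_map_tp_PiXuu (Γ : T.Gtp ≃ₜ* T.Gtp)
    (hXuu : (T.tp T.PiXuu).map Γ.toMulEquiv.toMonoidHom = T.tp T.PiXuu) :
    (T.tp T.PiX).map Γ.toMulEquiv.toMonoidHom = T.tp T.PiX :=
  T.map_tp_PiX_eq_of_PiXuu Γ (by
    rw [T.index_PiXuu, show l * (l * 2) = l ^ 2 * 2 by ring]
    exact not_four_dvd_of_odd T.l_odd 2 (Or.inr rfl)) hXuu

/-- **`X` from `X̲`** (abc-iut-L2-t7's index-`2` argument with `4 ∤ [Π_C : Π_{X̲}] = 2l` discharged, `l` odd).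
[cite: MochizukiEtTh2009, Prop 2.4 p.38] -/
theorem map_tp_PiX_eq_of_map_tp_PiXu (Γ : T.Gtp ≃ₜ* T.Gtp)
    (hXu : (T.tp T.PiXu).map Γ.toMulEquiv.toMonoidHom = T.tp T.PiXu) :
    (T.tp T.PiX).map Γ.toMulEquiv.toMonoidHom = T.tp T.PiX :=
  T.map_tp_PiX_eq_of_PiXu Γ (by
    rw [T.index_PiXu, show l * 2 = l ^ 1 * 2 by ring]
    exact not_four_dvd_of_odd T.l_odd 1 (Or.inl rfl)) hXu

/-- **`X̲` from `C̲`** (`l ≠ 1`, no further hypothesis): an automorphism of `Π^tp_C` stabilising `Π^tp_{C̲}` stabilises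
`Π^tp_{X̲}`, the normal core of the self-normalising `Π^tp_{C̲}` (`Π^tp_{X̲} ⊴ Π^tp_C` of index `2` in `Π^tp_{C̲}`;
Rmk. 2.1.1). [cite: MochizukiEtTh2009, Rmk 2.1.1 p.36] -/
theorem map_tp_PiXu_eq_of_map_tp_PiCu (hl : l ≠ 1) (Γ : T.Gtp ≃ₜ* T.Gtp)
    (hCu : (T.tp T.PiCu).map Γ.toMulEquiv.toMonoidHom = T.tp T.PiCu) :
    (T.tp T.PiXu).map Γ.toMulEquiv.toMonoidHom = T.tp T.PiXu := by
  haveI := T.tpPiXu_normal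
  exact Subgroup.map_eq_of_normal_of_relIndex_two T.tp_PiXu_le_tp_PiCu T.relIndex_tp_PiXu_tp_PiCu
    (T.normalizer_tp_PiCu_ne_top hl) Γ.toMulEquiv hCu

/-- **`C̲` from `C̲̲`** under `μ_l ⊆ K`: an automorphism of `Π^tp_C` stabilising `Π^tp_{C̲̲}` stabilises its
normaliser `N_{Π^tp_C}(Π^tp_{C̲̲}) = Π^tp_{C̲}` (Rmk. 2.6.1 `Aut_K(C̲̲) = μ_l`, abc-iut-L6-t23's `normalizer_tpPiCuu_eq`).
[cite: MochizukiEtTh2009, Rmk 2.6.1 p.40] -/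
theorem map_tp_PiCu_eq_of_map_tp_PiCuu (hmu : T.HasMuL) (Γ : T.Gtp ≃ₜ* T.Gtp)
    (hCuu : (T.tp T.PiCuu).map Γ.toMulEquiv.toMonoidHom = T.tp T.PiCuu) :
    (T.tp T.PiCu).map Γ.toMulEquiv.toMonoidHom = T.tp T.PiCu := by
  have h := Subgroup.map_equiv_normalizer_eq (T.tp T.PiCuu) Γ.toMulEquiv
  rw [hCuu, T.normalizer_tpPiCuu_eq hmu] at h
  exact h

/-- **`C̲` from `X̲̲`** under `μ_l ⊆ K` and the printed definition `hΘ` of `Δ̄_Θ`: an automorphism of `Π^tp_C`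
stabilising `Π^tp_{X̲̲}` stabilises its normaliser `N_{Π^tp_C}(Π^tp_{X̲̲}) = Π^tp_{C̲}` (Rmk. 2.6.1
`Aut_K(X̲̲) = μ_l × {±1}`, abc-iut-L2-t12's `normalizer_tpPiXuu_eq`). [cite: MochizukiEtTh2009, Rmk 2.6.1 p.40] -/
theorem map_tp_PiCu_eq_of_map_tp_PiXuu (hΘ : ⁅T.DeltaX, T.DeltaX⁆ ⊔ T.barKer = T.barTheta) (hmu : T.HasMuL)
    (Γ : T.Gtp ≃ₜ* T.Gtp) (hXuu : (T.tp T.PiXuu).map Γ.toMulEquiv.toMonoidHom = T.tp T.PiXuu) :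
    (T.tp T.PiCu).map Γ.toMulEquiv.toMonoidHom = T.tp T.PiCu := by
  have h := Subgroup.map_equiv_normalizer_eq (T.tp T.PiXuu) Γ.toMulEquiv
  rw [hXuu, T.normalizer_tpPiXuu_eq hΘ hmu] at h
  exact h

/-- **`C̲̲` from `X̲̲`** under `μ_l ⊆ K` and `hΘ`: an automorphism `Γ` of `Π^tp_C` stabilising `Π^tp_{X̲̲}` stabilises
`Π^tp_{C̲̲}` — `Γ(Π^tp_{C̲̲})` and `Π^tp_{C̲̲}` are index-`2` overgroups of `Π^tp_{X̲̲}` inside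
`Π^tp_{C̲} = N(Π^tp_{X̲̲}) = N(Π^tp_{C̲̲})`, of odd index `l` there (`Subgroup.eq_of_relIndex_two_of_odd_relIndex`; the
unique involution of `Aut_K(X̲̲) = μ_l × {±1}`, Rmk. 2.6.1). [cite: MochizukiEtTh2009, Rmk 2.6.1 p.40] -/
theorem map_tp_PiCuu_eq_of_map_tp_PiXuu (hΘ : ⁅T.DeltaX, T.DeltaX⁆ ⊔ T.barKer = T.barTheta) (hmu : T.HasMuL)
    (Γ : T.Gtp ≃ₜ* T.Gtp) (hXuu : (T.tp T.PiXuu).map Γ.toMulEquiv.toMonoidHom = T.tp T.PiXuu) :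
    (T.tp T.PiCuu).map Γ.toMulEquiv.toMonoidHom = T.tp T.PiCuu := by
  have hCu := map_tp_PiCu_eq_of_map_tp_PiXuu hΘ hmu Γ hXuu
  have hAM : T.tp T.PiXuu ≤ (T.tp T.PiCuu).map Γ.toMulEquiv.toMonoidHom := by
    conv_lhs => rw [← hXuu]
    exact Subgroup.map_mono T.tp_PiXuu_le_tp_PiCuu
  have hMB : (T.tp T.PiCuu).map Γ.toMulEquiv.toMonoidHom ≤ T.tp T.PiCu := by
    conv_rhs => rw [← hCu]
    exact Subgroup.map_mono T.tp_PiCuu_le_tp_PiCu'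
  have h2M : (T.tp T.PiXuu).relIndex ((T.tp T.PiCuu).map Γ.toMulEquiv.toMonoidHom) = 2 := by
    have h := Subgroup.relIndex_mul_index hAM
    have hidx : ((T.tp T.PiCuu).map Γ.toMulEquiv.toMonoidHom).index = (T.tp T.PiCuu).index :=
      Subgroup.index_map_of_bijective (f := Γ.toMulEquiv.toMonoidHom) Γ.toMulEquiv.bijective _
    rw [hidx, T.index_tp_PiXuu, T.index_tp_PiCuu] at h
    have hll : 0 < l * l := Nat.mul_pos (Nat.pos_of_ne_zero T.toCoverData.l_ne_zero)
      (Nat.pos_of_ne_zero T.toCoverData.l_ne_zero)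
    have h' : (T.tp T.PiXuu).relIndex ((T.tp T.PiCuu).map Γ.toMulEquiv.toMonoidHom) * (l * l) =
        2 * (l * l) := by rw [h]; ring
    exact Nat.eq_of_mul_eq_mul_right hll h'
  refine Subgroup.eq_of_relIndex_two_of_odd_relIndex hAM T.tp_PiXuu_le_tp_PiCuu hMB T.tp_PiCuu_le_tp_PiCu'
    (T.normalizer_tpPiCuu_eq hmu).ge h2M T.relIndex_tp_PiXuu_tp_PiCuu ?_
  rw [T.relIndex_tp_PiCuu_tp_PiCu]
  exact T.l_odd

/-! ### Prop. 2.4 clause by clause from «extension stabilising `Π^tp_Ÿ`» -/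

/-- **Prop. 2.4 (i) from extension + `Ÿ`** (`μ_l ⊆ K`, `hΘ`): if every topological automorphism of `Π^tp_{X̲̲}`
extends to one of `Π^tp_C` stabilising `Π^tp_Ÿ`, clause (i) of the typed `Prop24` holds — `X̲̲` (automatic, w6-d084),
`X` (index), `C̲` (normaliser), `X̲ = C̲ ∩ X` (w6-d094), `C̲̲` (odd index), `Ÿ` (hypothesis).
[cite: MochizukiEtTh2009, Prop 2.4 p.38] -/
theorem prop24_i_of_extendsStabilising_PiYddtp (hΘ : ⁅T.DeltaX, T.DeltaX⁆ ⊔ T.barKer = T.barTheta)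
    (hmu : T.HasMuL)
    (h : ∀ γ : ↥(T.tp T.PiXuu) ≃ₜ* ↥(T.tp T.PiXuu), T.ExtendsStabilising _ γ [T.PiYddtp])
    (γ : ↥(T.tp T.PiXuu) ≃ₜ* ↥(T.tp T.PiXuu)) : T.ExtendsStabilising _ γ T.tower := by
  obtain ⟨Γ, hΓ, hst⟩ := h γ
  have hXuu : (T.tp T.PiXuu).map Γ.toMulEquiv.toMonoidHom = T.tp T.PiXuu :=
    map_eq_self_of_restricts Γ.toMulEquiv γ.toMulEquiv hΓ
  have hX := map_tp_PiX_eq_of_map_tp_PiXuu Γ hXuu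
  have hCu := map_tp_PiCu_eq_of_map_tp_PiXuu hΘ hmu Γ hXuu
  have hXu := map_tp_PiXu_eq_of_map_tp_PiCu_of_map_tp_PiX Γ hCu hX
  have hCuu := map_tp_PiCuu_eq_of_map_tp_PiXuu hΘ hmu Γ hXuu
  have hYdd : T.PiYddtp.map Γ.toMulEquiv.toMonoidHom = T.PiYddtp := hst _ (by simp)
  refine ⟨Γ, hΓ, fun S hS => ?_⟩
  simp only [tower, List.mem_cons, List.mem_nil_iff, or_false] at hS
  rcases hS with rfl | rfl | rfl | rfl | rfl | rfl
  exacts [hXuu, hXu, hX, hCuu, hCu, hYdd]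

/-- **Prop. 2.4 (iii) from extension + `Ÿ`** (`μ_l ⊆ K`, `l ≠ 1`): if every topological automorphism of `Π^tp_{C̲̲}`
extends to one of `Π^tp_C` stabilising `Π^tp_Ÿ`, clause (iii) holds — `C̲̲` (automatic), `C̲` (normaliser), `X̲`
(normal core), `X` (index), `X̲̲ = C̲̲ ∩ X` (w6-d094), `Ÿ` (hypothesis). [cite: MochizukiEtTh2009, Prop 2.4 p.38] -/
theorem prop24_iii_of_extendsStabilising_PiYddtp (hmu : T.HasMuL) (hl : l ≠ 1)
    (h : ∀ γ : ↥(T.tp T.PiCuu) ≃ₜ* ↥(T.tp T.PiCuu), T.ExtendsStabilising _ γ [T.PiYddtp])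
    (γ : ↥(T.tp T.PiCuu) ≃ₜ* ↥(T.tp T.PiCuu)) : T.ExtendsStabilising _ γ T.tower := by
  obtain ⟨Γ, hΓ, hst⟩ := h γ
  have hCuu : (T.tp T.PiCuu).map Γ.toMulEquiv.toMonoidHom = T.tp T.PiCuu :=
    map_eq_self_of_restricts Γ.toMulEquiv γ.toMulEquiv hΓ
  have hCu := map_tp_PiCu_eq_of_map_tp_PiCuu hmu Γ hCuu
  have hXu := map_tp_PiXu_eq_of_map_tp_PiCu hl Γ hCu
  have hX := map_tp_PiX_eq_of_map_tp_PiXu Γ hXu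
  have hXuu := map_tp_PiXuu_eq_of_map_tp_PiCuu_of_map_tp_PiX Γ hCuu hX
  have hYdd : T.PiYddtp.map Γ.toMulEquiv.toMonoidHom = T.PiYddtp := hst _ (by simp)
  refine ⟨Γ, hΓ, fun S hS => ?_⟩
  simp only [tower, List.mem_cons, List.mem_nil_iff, or_false] at hS
  rcases hS with rfl | rfl | rfl | rfl | rfl | rfl
  exacts [hXuu, hXu, hX, hCuu, hCu, hYdd]

/-- **Prop. 2.4 (iv) from extension + `Ÿ`** (`l ≠ 1`, no further hypothesis): if every topological automorphism of
`Π^tp_{C̲}` extends to one of `Π^tp_C` stabilising `Π^tp_Ÿ`, clause (iv) holds — `C̲` (automatic), `X̲` (normal core),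
`X` (index), `Ÿ` (hypothesis). [cite: MochizukiEtTh2009, Prop 2.4 p.38] -/
theorem prop24_iv_of_extendsStabilising_PiYddtp (hl : l ≠ 1)
    (h : ∀ γ : ↥(T.tp T.PiCu) ≃ₜ* ↥(T.tp T.PiCu), T.ExtendsStabilising _ γ [T.PiYddtp])
    (γ : ↥(T.tp T.PiCu) ≃ₜ* ↥(T.tp T.PiCu)) :
    T.ExtendsStabilising _ γ [T.tp T.PiCu, T.tp T.PiXu, T.tp T.PiX, T.PiYddtp] := by
  obtain ⟨Γ, hΓ, hst⟩ := h γ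
  have hCu : (T.tp T.PiCu).map Γ.toMulEquiv.toMonoidHom = T.tp T.PiCu :=
    map_eq_self_of_restricts Γ.toMulEquiv γ.toMulEquiv hΓ
  have hXu := map_tp_PiXu_eq_of_map_tp_PiCu hl Γ hCu
  have hX := map_tp_PiX_eq_of_map_tp_PiXu Γ hXu
  have hYdd : T.PiYddtp.map Γ.toMulEquiv.toMonoidHom = T.PiYddtp := hst _ (by simp)
  refine ⟨Γ, hΓ, fun S hS => ?_⟩
  simp only [List.mem_cons, List.mem_nil_iff, or_false] at hS
  rcases hS with rfl | rfl | rfl | rfl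
  exacts [hCu, hXu, hX, hYdd]

/-! ### `Prop24` ⟺ «extension stabilising `Π^tp_Ÿ`», member by member -/

/-- **Prop. 2.4 from extension + `Ÿ`** (`μ_l ⊆ K`, `hΘ`, `l ≠ 1`): if for each member `Z ∈ {X̲̲, X̲, C̲̲, C̲}` every
topological automorphism of `Π^tp_Z` extends to a topological automorphism of `Π^tp_C` stabilising `Π^tp_Ÿ`, then the
typed `Prop24` holds.  The hypothesis is the absolute-anabelian content of the printed proof — the `K`-core
([Mzk3] Thm. 2.4) and the characteristic nature of `Π^tp_Ÿ` («as in the proof of Proposition 1.8») — and is NOT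
proved here. [cite: MochizukiEtTh2009, Prop 2.4 p.38] -/
theorem prop24_of_extendsStabilising_PiYddtp (hΘ : ⁅T.DeltaX, T.DeltaX⁆ ⊔ T.barKer = T.barTheta)
    (hmu : T.HasMuL) (hl : l ≠ 1)
    (h₁ : ∀ γ : ↥(T.tp T.PiXuu) ≃ₜ* ↥(T.tp T.PiXuu), T.ExtendsStabilising _ γ [T.PiYddtp])
    (h₂ : ∀ γ : ↥(T.tp T.PiXu) ≃ₜ* ↥(T.tp T.PiXu), T.ExtendsStabilising _ γ [T.PiYddtp])
    (h₃ : ∀ γ : ↥(T.tp T.PiCuu) ≃ₜ* ↥(T.tp T.PiCuu), T.ExtendsStabilising _ γ [T.PiYddtp])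
    (h₄ : ∀ γ : ↥(T.tp T.PiCu) ≃ₜ* ↥(T.tp T.PiCu), T.ExtendsStabilising _ γ [T.PiYddtp]) :
    T.Prop24 :=
  ⟨prop24_i_of_extendsStabilising_PiYddtp hΘ hmu h₁, prop24_ii_of_core h₂,
    prop24_iii_of_extendsStabilising_PiYddtp hmu hl h₃, prop24_iv_of_extendsStabilising_PiYddtp hl h₄⟩

/-- Conversely the typed `Prop24` contains «extension stabilising `Π^tp_Ÿ`» for each of the four members
(projection: `Π^tp_Ÿ` is on every printed list; no hypothesis). [cite: MochizukiEtTh2009, Prop 2.4 p.38] -/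
theorem extendsStabilising_PiYddtp_of_prop24 (h : T.Prop24) :
    (∀ γ : ↥(T.tp T.PiXuu) ≃ₜ* ↥(T.tp T.PiXuu), T.ExtendsStabilising _ γ [T.PiYddtp]) ∧
    (∀ γ : ↥(T.tp T.PiXu) ≃ₜ* ↥(T.tp T.PiXu), T.ExtendsStabilising _ γ [T.PiYddtp]) ∧
    (∀ γ : ↥(T.tp T.PiCuu) ≃ₜ* ↥(T.tp T.PiCuu), T.ExtendsStabilising _ γ [T.PiYddtp]) ∧
    (∀ γ : ↥(T.tp T.PiCu) ≃ₜ* ↥(T.tp T.PiCu), T.ExtendsStabilising _ γ [T.PiYddtp]) := by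
  obtain ⟨h₁, h₂, h₃, h₄⟩ := core_of_prop24 h
  refine ⟨fun γ => ?_, h₂, fun γ => ?_, fun γ => ?_⟩
  · obtain ⟨Γ, hΓ, hst⟩ := h₁ γ
    exact ⟨Γ, hΓ, fun S hS => hst S (by
      simp only [List.mem_cons, List.mem_nil_iff, or_false] at hS; subst hS; simp)⟩
  · obtain ⟨Γ, hΓ, hst⟩ := h₃ γ
    exact ⟨Γ, hΓ, fun S hS => hst S (by
      simp only [List.mem_cons, List.mem_nil_iff, or_false] at hS; subst hS; simp)⟩
  · obtain ⟨Γ, hΓ, hst⟩ := h₄ γ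
    exact ⟨Γ, hΓ, fun S hS => hst S (by
      simp only [List.mem_cons, List.mem_nil_iff, or_false] at hS; subst hS; simp)⟩

/-- **`Prop24` is EQUIVALENT over the interface to «extension stabilising `Π^tp_Ÿ`», member by member** — for
`l ≠ 1`, under `μ_l ⊆ K` (`T.HasMuL`, the standing hypothesis of Rmk. 2.6.1 / Cor. 2.9) and the printed definition
`hΘ` of `Δ̄_Θ`: `4` stabilisations instead of the typed `19` (w6-d094's core: `7`, granted Def. 2.5 (i)(a) — not
needed here).  WHAT PRINT'S HYPOTHESES LEAVE TO PROVE at a datum where Prop. 2.4 holds is exactly the right-hand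
side: the extension to `Π^tp_C` (the `K`-core, [Mzk3] Thm. 2.4) stabilising `Π^tp_Ÿ` (the theta quotient, «as in the
proof of Proposition 1.8»). [cite: MochizukiEtTh2009, Prop 2.4 p.38] -/
theorem prop24_iff_extendsStabilising_PiYddtp (hΘ : ⁅T.DeltaX, T.DeltaX⁆ ⊔ T.barKer = T.barTheta)
    (hmu : T.HasMuL) (hl : l ≠ 1) :
    T.Prop24 ↔
      ((∀ γ : ↥(T.tp T.PiXuu) ≃ₜ* ↥(T.tp T.PiXuu), T.ExtendsStabilising _ γ [T.PiYddtp]) ∧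
      (∀ γ : ↥(T.tp T.PiXu) ≃ₜ* ↥(T.tp T.PiXu), T.ExtendsStabilising _ γ [T.PiYddtp]) ∧
      (∀ γ : ↥(T.tp T.PiCuu) ≃ₜ* ↥(T.tp T.PiCuu), T.ExtendsStabilising _ γ [T.PiYddtp]) ∧
      (∀ γ : ↥(T.tp T.PiCu) ≃ₜ* ↥(T.tp T.PiCu), T.ExtendsStabilising _ γ [T.PiYddtp])) :=
  ⟨extendsStabilising_PiYddtp_of_prop24,
    fun h => prop24_of_extendsStabilising_PiYddtp hΘ hmu hl h.1 h.2.1 h.2.2.1 h.2.2.2⟩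

/-- The same equivalence with the printed definition of `Δ̄_Θ` in abc-iut-L2-t2's predicate currency
`CoverData.IsCommutatorTheta` (`ThetaCoversCommutatorTheta.lean`). [cite: MochizukiEtTh2009, Prop 2.4 p.38] -/
theorem prop24_iff_extendsStabilising_PiYddtp_of_isCommutatorTheta (hΘ : T.toCoverData.IsCommutatorTheta)
    (hmu : T.HasMuL) (hl : l ≠ 1) :
    T.Prop24 ↔
      ((∀ γ : ↥(T.tp T.PiXuu) ≃ₜ* ↥(T.tp T.PiXuu), T.ExtendsStabilising _ γ [T.PiYddtp]) ∧
      (∀ γ : ↥(T.tp T.PiXu) ≃ₜ* ↥(T.tp T.PiXu), T.ExtendsStabilising _ γ [T.PiYddtp]) ∧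
      (∀ γ : ↥(T.tp T.PiCuu) ≃ₜ* ↥(T.tp T.PiCuu), T.ExtendsStabilising _ γ [T.PiYddtp]) ∧
      (∀ γ : ↥(T.tp T.PiCu) ≃ₜ* ↥(T.tp T.PiCu), T.ExtendsStabilising _ γ [T.PiYddtp])) :=
  prop24_iff_extendsStabilising_PiYddtp hΘ.commutator_sup_barKer hmu hl

end TemperedCoverData

end ThetaCovers

end Literature.AnabelianGeometry.EtaleTheta
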